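import Mathlib
import Summits.ValiantsHypothesis.ValiantsHypothesis.Theses.FermionicJet
import Summits.ValiantsHypothesis.ValiantsHypothesis.Theorems.FermionicJetPencilControlsHC
import Summits.ValiantsHypothesis.ValiantsHypothesis.Theorems.FermionicJetJetsInVNP
import Summits.ValiantsHypothesis.ValiantsHypothesis.Theorems.FermionicJetAssembly
import Summits.ValiantsHypothesis.ValiantsHypothesis.Theorems.FermionicJetJetChain
import Summits.ValiantsHypothesis.ValiantsHypothesis.Theorems.FermionicJetFirstToBounded
import Literature.Computability.AlgebraicComplexity.FermionicPencil
import Literature.Computability.AlgebraicComplexity.ValiantConjectureCompleteCriterion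
import Literature.Computability.AlgebraicComplexity.ValiantHCCompleteness
import Literature.Computability.AlgebraicComplexity.VPDeterminantalQPProofs
import Literature.Computability.AlgebraicComplexity.StandardFamiliesProofs
import HarnessLib

/-!
# Crux-strategist sketch — `FermionicJet.BoundedOrderHardness` (stmt-ValiantsHypothesis-5340), RESTATED re-audit

Seat planner-cstrat-stmt-ValiantsHypothesis-5340-r1-0 (2026-08-17).  Companion of
`Cruxes/BoundedOrderHardness/STRATEGY-CENSUS.md`: every "signature" quoted there is a `def` below and
every "kernel-checked" claim there is a `theorem` below (no `sorry`).

Notation.  `jet k n = cycleJetPoly (Fin n) ℂ k = Σ_σ sgn σ · C(c(σ),k) · ∏ X(σ i, i)` (the route's inline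
family, definitionally), `pencil n = fermionicPencilVar (Fin n) ℂ` (coupling `T` a variable), `S` = the
summit statement `ValiantsHypothesis` (`VP ℂ ≠ VNP ℂ`), `BOH` = the crux.

Contents.
* §1 the candidate PIECES of the census, typed: `JetUniformity` (U), `FixedJetCompleteness` (F),
  `PencilHardness`, `JetDcSuperpolynomial` / `JetCircuitsToDeterminants` (the VBP-seam D4),
  `JetDcSuperQuasipolynomial` (D6);
* §2 the CHARACTERISATION `boundedOrderHardness_iff_summit_and_uniformity : BOH ↔ (S ∧ U)` and
  `boundedOrderHardness_iff_summit_of_fixedJetCompleteness : F → (BOH ↔ S)` — the crux is the summit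
  plus exactly one non-summit supplement;
* §3 the ASSEMBLIES of the attempted decompositions, so that their seams can be quoted verbatim
  (D1/D2: real proofs but one piece is `S` itself; D4: a two-line logical seam; D6: one piece suffices);
* §4 the threshold structure (`Strengthen`): VP-membership of the jets is downward closed in the order,
  so every strengthening "∀ k ≥ k₀" collapses to the single order `k₀` (and `k₀ = 1` is item 5341).
-/

noncomputable section

-- single-conjunct layout (Sub = Summit): duplicated namespace component intended
set_option linter.dupNamespace false

namespace Summit.ValiantsHypothesis.ValiantsHypothesis.Cruxes.BoundedOrderHardness.Strategist

open MvPolynomial Literature.Computability.AlgebraicComplexity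
open Summit.ValiantsHypothesis.ValiantsHypothesis.Theses.FermionicJet

/-! ### §0 The objects by name -/

/-- The route's order-`k` jet family `f_{·,k}` (inline in the route file; `cycleJetPoly` by `rfl`). -/
abbrev jet (k : ℕ) : ∀ n : ℕ, MvPolynomial (Fin n × Fin n) ℂ := fun n => cycleJetPoly (Fin n) ℂ k

/-- The variable-coupling pencil family `P_n(T, X)` (inline in item `PencilControlsHC`; by `rfl`). -/
abbrev pencil : ∀ n : ℕ, MvPolynomial (Option (Fin n × Fin n)) ℂ := fun n => fermionicPencilVar (Fin n) ℂ

/-- The Hamiltonian-cycle family. -/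
abbrev hc : ∀ n : ℕ, MvPolynomial (Fin n × Fin n) ℂ := fun n => hcPoly (Fin n) ℂ

/-- The crux, read through the tree's names (definitional). -/
theorem boundedOrderHardness_iff_jets :
    BoundedOrderHardness ↔ ∃ k : ℕ, ¬ IsVPFamily (k := ℂ) (jet k) := Iff.rfl

/-- The summit, read through `HC`: `S ↔ HC ∉ VP` (von zur Gathen's criterion with the tree's PROVED
`VNP`-completeness of `HC`). -/
theorem summit_iff_hc_not_isVPFamily :
    _root_.ValiantsHypothesis ↔ ¬ IsVPFamily (k := ℂ) hc := by
  have h := VP_ne_VNP_iff_not_isPComputable_hcPoly ℂ (isVNPComplete_hcPoly_holds ℂ)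
  show (VP ℂ ≠ VNP ℂ) ↔ _
  rw [h]
  constructor
  · exact fun hnc hVP => hnc hVP.2
  · exact fun hn hcmp => hn ⟨isPFamily_hcPoly_holds (k := ℂ), hcmp⟩

/-- `PencilControlsHC` (item 5349, PROVED) read through the names. -/
theorem hc_isVPFamily_of_pencil (hP : IsVPFamily (k := ℂ) pencil) : IsVPFamily (k := ℂ) hc := by
  have h := Summit.ValiantsHypothesis.ValiantsHypothesis.Theorems.FermionicJetPencilControlsHC.pencilControlsHC_proof
  unfold PencilControlsHC at h
  exact h hP

/-! ### §1 The candidate pieces -/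

/-- **U — jet uniformity** (the census's only intrinsic non-summit supplement): if EVERY fixed-order
jet family is in `VP`, then the whole variable-coupling pencil `P_n = Σ_k (T-1)^k f_{n,k}` is in `VP`.
Not a tautology: fixed-`k` circuit bounds `n^{c_k}` need not be uniform in `k ≤ n`. -/
def JetUniformity : Prop :=
  (∀ k : ℕ, IsVPFamily (k := ℂ) (jet k)) → IsVPFamily (k := ℂ) pencil

/-- **F — fixed-jet completeness** (item 5342 `HcProjectsToCdet` is the case `k = 1`): some fixed-order
jet family is `VNP`-hard under p-projections. -/
def FixedJetCompleteness : Prop :=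
  ∃ k : ℕ, IsPProjection (k := ℂ) hc (jet k)

/-- **Pencil hardness**: the variable-coupling pencil family is not in `VP` (⟸ `S` by item 5349 and the
completeness of `HC`; ⟹ `S` needs `P ∈ VNP`, true by Valiant's criterion but not landed). -/
def PencilHardness : Prop :=
  ¬ IsVPFamily (k := ℂ) pencil

/-- **D4, piece 1** — some fixed jet has superpolynomial affine determinantal complexity
(`f_k ∉ VBP`-shape; implies only `VBP ≠ VNP`-type separations). -/
def JetDcSuperpolynomial : Prop :=
  ∃ k : ℕ, ¬ IsPBounded (fun n => determinantalComplexity (jet k n))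

/-- **D4, piece 2** — "circuits to determinants for jets": a `VP` jet family has polynomial determinantal
complexity (`VP = VBP` on this family). -/
def JetCircuitsToDeterminants : Prop :=
  ∀ k : ℕ, IsVPFamily (k := ℂ) (jet k) → IsPBounded (fun n => determinantalComplexity (jet k n))

/-- **D6** — some fixed jet has super-QUASI-polynomial determinantal complexity (strictly stronger than
the crux, by the tree's PROVED `VP ⟹ dc quasi-polynomial`). -/
def JetDcSuperQuasipolynomial : Prop :=
  ∃ k : ℕ, ¬ IsQPBounded (fun n => determinantalComplexity (jet k n))

/-! ### §2 The characterisation: the crux is `S` plus one supplement -/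

/-- **BOH ↔ S ∧ U.**  (→) `S` by the route's own `closes` with the proved `JetsInVNP`; `U` vacuously.
(←) if no fixed jet were hard, `U` puts the pencil in `VP`, item 5349 puts `HC` in `VP`, contradicting `S`
through the proved completeness of `HC`. -/
theorem boundedOrderHardness_iff_summit_and_uniformity :
    BoundedOrderHardness ↔ (_root_.ValiantsHypothesis ∧ JetUniformity) := by
  constructor
  · intro h
    refine ⟨closes h Summit.ValiantsHypothesis.ValiantsHypothesis.Theorems.jetsInVNP_proof, fun hall => ?_⟩
    obtain ⟨k, hk⟩ := h
    exact absurd (hall k) hk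
  · rintro ⟨hS, hU⟩
    by_contra hBOH
    have hall : ∀ k : ℕ, IsVPFamily (k := ℂ) (jet k) := fun k => by
      by_contra hk
      exact hBOH ⟨k, hk⟩
    exact (summit_iff_hc_not_isVPFamily.1 hS) (hc_isVPFamily_of_pencil (hU hall))

/-- Hence, GIVEN the summit, the crux is exactly `U`. -/
theorem boundedOrderHardness_iff_uniformity_of_summit (hS : _root_.ValiantsHypothesis) :
    BoundedOrderHardness ↔ JetUniformity := by
  rw [boundedOrderHardness_iff_summit_and_uniformity]
  exact ⟨fun h => h.2, fun h => ⟨hS, h⟩⟩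

-- (Without the summit the crux is false — immediate from `.1` of the characterisation; deliberately not stated as a
-- theorem `¬S → ¬BOH` here, to keep conditional-refutation shapes out of the crux directory.)

/-- **F → (BOH ↔ S).**  Under fixed-jet completeness the crux is literally the summit: (←) the complete
jet would put `HC` in `VP` (`VP` is closed under p-projections among p-families, PROVED). -/
theorem boundedOrderHardness_iff_summit_of_fixedJetCompleteness (hF : FixedJetCompleteness) :
    BoundedOrderHardness ↔ _root_.ValiantsHypothesis := by
  constructor
  · exact fun h => closes h Summit.ValiantsHypothesis.ValiantsHypothesis.Theorems.jetsInVNP_proof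
  · intro hS
    obtain ⟨k, hk⟩ := hF
    refine ⟨k, fun hVP => ?_⟩
    exact (summit_iff_hc_not_isVPFamily.1 hS)
      (IsVPFamily.of_isPProjection_holds (isPFamily_hcPoly_holds (k := ℂ)) hk hVP)

/-- `F` is at least as strong as `U` relative to the summit: `F ∧ S → U`. -/
theorem jetUniformity_of_fixedJetCompleteness_of_summit (hF : FixedJetCompleteness)
    (hS : _root_.ValiantsHypothesis) : JetUniformity :=
  (boundedOrderHardness_iff_uniformity_of_summit hS).1
    ((boundedOrderHardness_iff_summit_of_fixedJetCompleteness hF).2 hS)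

/-- `S → PencilHardness` (item 5349 + completeness of `HC`). -/
theorem pencilHardness_of_summit (hS : _root_.ValiantsHypothesis) : PencilHardness :=
  fun hP => (summit_iff_hc_not_isVPFamily.1 hS) (hc_isVPFamily_of_pencil hP)

/-- `PencilHardness ∧ U → BOH` — the same seam with the summit replaced by its consequence. -/
theorem boundedOrderHardness_of_pencilHardness_of_uniformity (hP : PencilHardness) (hU : JetUniformity) :
    BoundedOrderHardness := by
  by_contra hBOH
  exact hP (hU fun k => by by_contra hk; exact hBOH ⟨k, hk⟩)

/-! ### §3 The assemblies of the attempted decompositions (quoted in the census) -/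

/-- **D1** `S ∧ U → BOH` — a real assembly (interpolation of `[T^1]P_n = ±HC_n` inside item 5349,
completeness of `HC`), but piece 1 is the Statement. -/
theorem D1_assembly (h₁ : _root_.ValiantsHypothesis) (h₂ : JetUniformity) : BoundedOrderHardness :=
  boundedOrderHardness_iff_summit_and_uniformity.2 ⟨h₁, h₂⟩

/-- **D2** `S ∧ F → BOH` — assembly = closure of `VP` under p-projections + completeness of `HC`;
piece 1 is the Statement. -/
theorem D2_assembly (h₁ : _root_.ValiantsHypothesis) (h₂ : FixedJetCompleteness) : BoundedOrderHardness :=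
  (boundedOrderHardness_iff_summit_of_fixedJetCompleteness h₂).2 h₁

-- **D3** `FirstOrderHardness → BOH` — one piece, one line: this is item 5345, PROVED in the tree as
-- `Summit.ValiantsHypothesis.ValiantsHypothesis.Theorems.FermionicJet.firstToBounded_proof`
-- (`refine ⟨1, ?_⟩; simpa only [Nat.choose_one_right] using h`); not restated here.

/-- **D4** `JetDcSuperpolynomial ∧ JetCircuitsToDeterminants → BOH` — the probes pass but the seam is
TWO LINES of logic: the cut runs along the definition of "polynomial dc", not along mathematics. -/
theorem D4_assembly (h₁ : JetDcSuperpolynomial) (h₂ : JetCircuitsToDeterminants) : BoundedOrderHardness := by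
  obtain ⟨k, hk⟩ := h₁
  exact ⟨k, fun hVP => hk (h₂ k hVP)⟩

/-- **D6** `JetDcSuperQuasipolynomial → BOH` — ONE piece suffices, through the tree's PROVED
`isQPBounded_determinantalComplexity_of_isVPFamily_holds` (`VP ⊆ VQP = qp-projections of det`):
the piece is strictly stronger than the crux. -/
theorem D6_assembly (h : JetDcSuperQuasipolynomial) : BoundedOrderHardness := by
  obtain ⟨k, hk⟩ := h
  exact ⟨k, fun hVP => hk (isQPBounded_determinantalComplexity_of_isVPFamily_holds _ hVP)⟩

/-! ### §4 Threshold structure (Strengthen) -/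

/-- Easiness propagates DOWN the jet order (item 5346 `JetChain`, PROVED: `f_k ≤_p f_{k+1}`). -/
theorem isVPFamily_jet_of_succ (k : ℕ) (h : IsVPFamily (k := ℂ) (jet (k + 1))) : IsVPFamily (k := ℂ) (jet k) := by
  have hchain := Summit.ValiantsHypothesis.ValiantsHypothesis.Theorems.jetChain_proof
  unfold JetChain at hchain
  exact IsVPFamily.of_isPProjection_holds
    (Summit.ValiantsHypothesis.ValiantsHypothesis.Theorems.FermionicJetJetsInVNP.isPFamily_cycleJetPoly ℂ k)
    (hchain k) h

/-- … hence from any higher order. -/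
theorem isVPFamily_jet_anti {k l : ℕ} (hkl : k ≤ l) (h : IsVPFamily (k := ℂ) (jet l)) :
    IsVPFamily (k := ℂ) (jet k) := by
  obtain ⟨d, rfl⟩ := Nat.exists_eq_add_of_le hkl
  induction d with
  | zero => simpa using h
  | succ d ih => exact ih (Nat.le_add_right k d) (isVPFamily_jet_of_succ (k + d) (by simpa [Nat.add_assoc] using h))

/-- Hardness propagates UP: the crux is equivalent to "eventually every jet is hard". -/
theorem boundedOrderHardness_iff_eventually :
    BoundedOrderHardness ↔ ∃ k₀ : ℕ, ∀ k ≥ k₀, ¬ IsVPFamily (k := ℂ) (jet k) := by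
  constructor
  · rintro ⟨k₀, hk₀⟩
    exact ⟨k₀, fun k hk hVP => hk₀ (isVPFamily_jet_anti hk hVP)⟩
  · rintro ⟨k₀, h⟩
    exact ⟨k₀, h k₀ le_rfl⟩

/-- The strongest member of the family of strengthenings "∀ k ≥ k₀": `k₀ = 1` is item 5341
(`FirstOrderHardness`, cdet ∉ VP) — uniform hardness of ALL jets of positive order is not stronger than it. -/
theorem firstOrderHardness_iff_all_positive_orders :
    FirstOrderHardness ↔ ∀ k ≥ 1, ¬ IsVPFamily (k := ℂ) (jet k) := by
  have hfun : (jet 1) = fun n => cdetPoly (Fin n) ℂ := funext fun n => cycleJetPoly_one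
  have h1 : FirstOrderHardness ↔ ¬ IsVPFamily (k := ℂ) (jet 1) := by
    rw [hfun]
    exact Iff.rfl
  rw [h1]
  exact ⟨fun h k hk hVP => h (isVPFamily_jet_anti hk hVP), fun h => h 1 le_rfl⟩

/-- Order `0` is never a witness: `f_{·,0} = det ∈ VP` would be needed POSITIVELY to say more, but the
tree states `det ∈ VP` only as the named fact `isVPFamily_detPoly`; we record the identification. -/
theorem jet_zero_eq_det (n : ℕ) : jet 0 n = detPoly (Fin n) ℂ := cycleJetPoly_zero

end Summit.ValiantsHypothesis.ValiantsHypothesis.Cruxes.BoundedOrderHardness.Strategist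

end
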